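import Literature.NumberTheory.Automorphic.LanglandsTunnellAdjoint
import Literature.NumberTheory.Automorphic.AutomorphicRepsGLSatakeFlathProofs
import HarnessLib

/-!
# Langlands–Tunnell: the target from the current leaves of its decomposition

Trunk AutomorphicL / family `lang` (topic `NumberTheory/Automorphic`).  Pure assembly: everything
in this file is PROVED (no `sorry`, no definition, no new named fact, nothing restated).

The named fact `Literature.NumberTheory.Automorphic.langlands_tunnell`
(`Automorphic/LanglandsTunnell`: an odd irreducible continuous `ρ : Γ_ℚ → GL_2(ℂ)` with solvable
image arises from a weight-one newform) is decomposed in the tree along the lines of Tunnell,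
*Artin's conjecture for representations of octahedral type*, Bull. AMS (N.S.) 5 (1981), p. 173
("Artin [1] proved this for monomial representations … In [5] Langlands proved Artin's conjecture
for all two-dimensional representations of tetrahedral type … We show that recent work of
Jacquet, Piatetski-Shapiro, and Shalika [4] can be used to prove that the octahedral case
follows") and Gelbart, *Three lectures …* (1997), §5.3, §7.1–7.2 and Props. 4.1–4.2, by several
hands and in several files:

* the case split (Klein; `GaloisRepresentations/ProjectiveTypeSolvable`) and the passage to
  weight one over `ℚ` (`StrongArtinGL2`, `StrongArtinGL2Proofs`);
* the dihedral case from Artin reciprocity and automorphic induction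
  (`LanglandsTunnellMonomial`);
* the tetrahedral case from cubic descent with central character, the Gelbart–Jacquet lift,
  `π(Ad σ)` and Jacquet–Shalika (`LanglandsTetrahedral`, `LanglandsTunnellFrobenius`), with
  `π(Ad σ)` itself from Artin reciprocity and automorphic induction (`LanglandsTunnellAdjoint`);
* the octahedral case from cyclic descent, the quadratic twist and Tunnell's Lemma, the Lemma
  from the fibres of quadratic base change and the cuspidality of Tunnell's cubic lifts
  (`TunnellOctahedralLocal`, `TunnellOctahedralGlobal`, `TunnellLemma`,
  `LanglandsTunnellFrobenius`), Chebotarev's theorem being replaced throughout by the proved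
  Frobenius density theorem (`GaloisRepresentations/FrobeniusDensityTheorem`);
* and the two Satake facts of Flath used by every layer — uniqueness and cofiniteness of Satake
  parameters of automorphic representations of `GL_n(𝔸_K)` — which are now **theorems**
  (`AutomorphicRepData.hasSatakeParamAt_unique_holds`, `…_cofinite_holds` of
  `AutomorphicRepsGLSatakeFlathProofs`).

This file records, as single proved implications, the target and its general-`F` companions
from the **current leaves**, so that the trust base of `langlands_tunnell` can be read off one
statement:

* `strongArtin_of_isTetrahedralType_of_leaves` — Langlands' tetrahedral theorem from five leaves:
  Artin reciprocity for characters (`artinReciprocity_character`), automorphic induction of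
  characters in prime degree (`automorphicInduction_character`), cubic descent with central
  character (`exists_cuspidal_descent_det_cubic`), the Gelbart–Jacquet adjoint lift
  (`GelbartJacquet_adjoint_lift`) and Jacquet–Shalika rigidity (`JacquetShalika_eq_of_rsData_eq`).
* `tunnell_lemma_of_leaves` — Tunnell's Lemma from the fibres of quadratic base change
  (`ArthurClozel_fibres_quadratic`) and the cuspidality of the cubic lifts
  (`tunnell_cuspidal_cubic_lifts`).
* `strongArtin_of_isOctahedralType_of_leaves`, `strongArtin_of_isSolvable_of_leaves` — Tunnell's
  Theorem, and the strong Artin conjecture for irreducible `σ : Γ_F → GL_2(ℂ)` with solvable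
  image over any number field `F` (Gelbart 1997, Thm. 2.1 for solvable image), from the nine
  leaves: the five above, cyclic descent of prime degree (`cuspidal_descent_cyclic`), the
  quadratic twist (`exists_twist_quadraticSign`) and the two of Tunnell's Lemma.
* `langlands_tunnell_of_leaves` — lang.S30, `langlands_tunnell ρ` for every `ρ`, from the nine
  leaves and Gelbart's Prop. 4.1 (`frobSatakeCompatibleAt_of_isPiOfArtinRep`) and Prop. 4.2
  (`exists_isNewform1_of_isPiOfArtinRep`, the weight-one dictionary) over `ℚ`.

Each leaf is a named fact `def … : Prop` carrying its own citation; each is a theorem of the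
theory of automorphic representations of `GL_1`, `GL_2`, `GL_3` over number fields (class field
theory, the trace formula, converse theorems, Rankin–Selberg theory, newform theory in weight
one) for which the Mathlib pin has no carriers beyond the tree's `Automorphic/AutomorphicRepsGL`.

## References

* J. Tunnell, *Artin's conjecture for representations of octahedral type*, Bull. AMS (N.S.) 5
  (1981), 173–175: p. 173, Lemma (p. 174), Theorem (p. 175). [Tunnell1981]
* R. P. Langlands, *Base Change for GL(2)*, Ann. of Math. Stud. 96 (1980), §3.
  [LanglandsBaseChange1980]
* S. Gelbart, *Three lectures on the modularity of `ρ̄_{E,3}` and the Langlands reciprocity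
  conjecture*, in Cornell–Silverman–Stevens (1997): Thm. 1.3, Thm. 2.1, Props. 4.1–4.2, §5.3,
  §7.1–7.2. [Gelbart1997]
* D. Flath, *Decomposition of representations into tensor products*, Corvallis (1979), Thm. 3.
  [FlathCorvallis1979]
-/

noncomputable section

open scoped Classical

namespace Literature.NumberTheory.Automorphic

section Leaves

/-- **Langlands' tetrahedral theorem from the current leaves** (Langlands 1980, §3; Gelbart
1997, §7.1): the strong Artin conjecture for `σ : Γ_F → GL_2(ℂ)` of tetrahedral type, from
Artin reciprocity for characters, automorphic induction of characters in prime degree, cubic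
descent with central character, the Gelbart–Jacquet adjoint lift and Jacquet–Shalika rigidity —
`strongArtin_of_isTetrahedralType_of_reciprocity_of_induction` (`LanglandsTunnellAdjoint`) with
the two Satake facts discharged by `AutomorphicRepData.hasSatakeParamAt_unique_holds` and
`AutomorphicRepData.hasSatakeParamAt_cofinite_holds` (Flath 1979, Thm. 3, proved in
`AutomorphicRepsGLSatakeFlathProofs`).
[cite: Gelbart1997, §7.1, pp. 254–257] [cite: LanglandsBaseChange1980, §3] -/
theorem strongArtin_of_isTetrahedralType_of_leaves
    (hR : GaloisRepresentations.artinReciprocity_character) (hAI : automorphicInduction_character)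
    (hdesc3 : exists_cuspidal_descent_det_cubic) (hGJ : GelbartJacquet_adjoint_lift)
    (hJS : JacquetShalika_eq_of_rsData_eq) :
    strongArtin_of_isTetrahedralType :=
  strongArtin_of_isTetrahedralType_of_reciprocity_of_induction hR hAI hdesc3 hGJ hJS
    (fun π => AutomorphicRepData.hasSatakeParamAt_unique_holds π)
    (fun π => AutomorphicRepData.hasSatakeParamAt_cofinite_holds π)

/-- **Tunnell's Lemma from the current leaves** (Tunnell 1981, Lemma, p. 174: "There exists a
unique index `i` such that `BC_{K/F}(π_i) = π(ρ_K)`", existence half, `tunnell_lemma`): from the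
fibres of quadratic base change (Arthur–Clozel III.3.1, `ArthurClozel_fibres_quadratic`) and the
cuspidality of the non-normal cubic lifts (Jacquet–Piatetski-Shapiro–Shalika 1981,
`tunnell_cuspidal_cubic_lifts`) — `tunnell_lemma_of_fibres'` (`LanglandsTunnellFrobenius`,
Chebotarev-free) with the two Satake facts discharged (Flath 1979, Thm. 3).
[cite: Tunnell1981, Lemma (p. 174)] -/
theorem tunnell_lemma_of_leaves (ha : ArthurClozel_fibres_quadratic)
    (hb : tunnell_cuspidal_cubic_lifts) : tunnell_lemma :=
  tunnell_lemma_of_fibres' ha hb (fun π => AutomorphicRepData.hasSatakeParamAt_unique_holds π)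
    (fun π => AutomorphicRepData.hasSatakeParamAt_cofinite_holds π)

/-- **Tunnell's Theorem from the current leaves** (Tunnell 1981, Theorem, p. 175: "Let `ρ` be an
octahedral representation of `Gal(\bar Q/F)`.  Then `π(ρ)` exists"): the strong Artin conjecture
for `σ : Γ_F → GL_2(ℂ)` of octahedral type from nine named facts — Artin reciprocity for
characters, automorphic induction of characters in prime degree, Langlands' base change for
`GL(2)` in three forms (`exists_cuspidal_descent_det_cubic`, `cuspidal_descent_cyclic`,
`ArthurClozel_fibres_quadratic`), the Gelbart–Jacquet adjoint lift, Jacquet–Shalika rigidity,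
the quadratic twist (`exists_twist_quadraticSign`) and the cuspidality of Tunnell's cubic lifts
(`tunnell_cuspidal_cubic_lifts`) — via `strongArtin_of_isOctahedralType_of_tunnell_lemma`
(`TunnellOctahedralGlobal`) fed with the tetrahedral case, the dihedral case
(`strongArtin_of_isDihedralType_of_reciprocity_of_induction`, `LanglandsTunnellMonomial`) and
Tunnell's Lemma from the leaves, the Satake facts being theorems (Flath 1979, Thm. 3).
[cite: Tunnell1981, Theorem (p. 175)] [cite: Gelbart1997, §7.2, pp. 257–259] -/
theorem strongArtin_of_isOctahedralType_of_leaves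
    (hR : GaloisRepresentations.artinReciprocity_character) (hAI : automorphicInduction_character)
    (hdesc3 : exists_cuspidal_descent_det_cubic) (hGJ : GelbartJacquet_adjoint_lift)
    (hJS : JacquetShalika_eq_of_rsData_eq) (hdesc : cuspidal_descent_cyclic)
    (htw : exists_twist_quadraticSign) (ha : ArthurClozel_fibres_quadratic)
    (hb : tunnell_cuspidal_cubic_lifts) :
    strongArtin_of_isOctahedralType :=
  strongArtin_of_isOctahedralType_of_tunnell_lemma
    (strongArtin_of_isTetrahedralType_of_leaves hR hAI hdesc3 hGJ hJS)
    (strongArtin_of_isDihedralType_of_reciprocity_of_induction hR hAI) hdesc htw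
    (tunnell_lemma_of_leaves ha hb) (fun π => AutomorphicRepData.hasSatakeParamAt_unique_holds π)
    (fun π => AutomorphicRepData.hasSatakeParamAt_cofinite_holds π)

/-- **The strong Artin conjecture for two-dimensional `σ` with solvable image, from the current
leaves** (Gelbart 1997, Thm. 2.1 restricted to solvable image; Tunnell 1981, p. 173): for every
number field `F` and every irreducible `σ : Γ_F → GL_2(ℂ)` with solvable image, `π(σ)` exists
(`strongArtin_of_isSolvable`), from the nine named facts of
`strongArtin_of_isOctahedralType_of_leaves` — the three cases (dihedral:
`LanglandsTunnellMonomial`; tetrahedral and octahedral: above) glued by the proved trichotomy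
`strongArtin_of_isSolvable_of_three_cases` (`StrongArtinGL2Proofs`).
[cite: Tunnell1981, p. 173 and Theorem] [cite: Gelbart1997, Thm. 2.1] -/
theorem strongArtin_of_isSolvable_of_leaves
    (hR : GaloisRepresentations.artinReciprocity_character) (hAI : automorphicInduction_character)
    (hdesc3 : exists_cuspidal_descent_det_cubic) (hGJ : GelbartJacquet_adjoint_lift)
    (hJS : JacquetShalika_eq_of_rsData_eq) (hdesc : cuspidal_descent_cyclic)
    (htw : exists_twist_quadraticSign) (ha : ArthurClozel_fibres_quadratic)
    (hb : tunnell_cuspidal_cubic_lifts) :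
    strongArtin_of_isSolvable :=
  strongArtin_of_isSolvable_of_three_cases
    (strongArtin_of_isDihedralType_of_reciprocity_of_induction hR hAI)
    (strongArtin_of_isTetrahedralType_of_leaves hR hAI hdesc3 hGJ hJS)
    (strongArtin_of_isOctahedralType_of_leaves hR hAI hdesc3 hGJ hJS hdesc htw ha hb)

/-- **lang.S30 (Langlands–Tunnell) from the current leaves of its decomposition**: for every
`ρ : Γ_ℚ → GL_2(ℂ)`, `langlands_tunnell ρ` (odd, irreducible, solvable image ⇒ `ρ` arises from a
weight-one newform; Gelbart 1997, Thm. 1.3 with Deligne–Serre) follows from eleven named facts: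
Artin reciprocity for characters (Tate), automorphic induction of characters in prime degree
(Arthur–Clozel Thm. 6.2), Langlands' base change for `GL(2)` in three forms
(`exists_cuspidal_descent_det_cubic`, `cuspidal_descent_cyclic`, `ArthurClozel_fibres_quadratic`),
the Gelbart–Jacquet adjoint lift, Jacquet–Shalika rigidity, the quadratic twist, the
cuspidality of Tunnell's cubic lifts (Jacquet–Piatetski-Shapiro–Shalika 1981), and, over `ℚ`,
Gelbart's Prop. 4.1 (`frobSatakeCompatibleAt_of_isPiOfArtinRep`) and Prop. 4.2
(`exists_isNewform1_of_isPiOfArtinRep`).  Everything else — Klein's trichotomy, the Galois side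
of both monomial inputs, Tunnell's local argument, Frobenius density in place of Chebotarev,
Flath's Satake facts — is proved in the tree (`langlands_tunnell_of_strongArtin` applied to
`strongArtin_of_isSolvable_of_leaves`).
[cite: Tunnell1981, p. 173, Lemma and Theorem] [cite: Gelbart1997, Thm. 1.3, §2.6, Props. 4.1–4.2,
§7.1–7.2] -/
theorem langlands_tunnell_of_leaves
    (hR : GaloisRepresentations.artinReciprocity_character) (hAI : automorphicInduction_character)
    (hdesc3 : exists_cuspidal_descent_det_cubic) (hGJ : GelbartJacquet_adjoint_lift)
    (hJS : JacquetShalika_eq_of_rsData_eq) (hdesc : cuspidal_descent_cyclic)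
    (htw : exists_twist_quadraticSign) (ha : ArthurClozel_fibres_quadratic)
    (hb : tunnell_cuspidal_cubic_lifts)
    (hAE : frobSatakeCompatibleAt_of_isPiOfArtinRep) (hW1 : exists_isNewform1_of_isPiOfArtinRep)
    (ρ : GaloisRepresentations.FramedArtinRep ℚ 2) : langlands_tunnell ρ :=
  langlands_tunnell_of_strongArtin
    (strongArtin_of_isSolvable_of_leaves hR hAI hdesc3 hGJ hJS hdesc htw ha hb) hAE hW1 ρ

end Leaves

end Literature.NumberTheory.Automorphic

end

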